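import Summits.CriticalPhenomena.PercolationContinuityZ3.Theorems.PercNearOneGluingNoHeavyQuantGluedTripleTrueFloor
import Summits.CriticalPhenomena.PercolationContinuityZ3.Theorems.PercNearOneGluingNoHeavyQuantDepthOneTripleForests
import HarnessLib

/-!
# QUANT lane R8, T-DEC: the identical glued triple at its true floor ON THE NODE'S BINDER — three copies of a glued sibling record at every
# floor `x ≤ q·g`, extended by any number of blob-hull-reducible and tame siblings (prim-quant-census-2 gen 80)

builds on p205010 (kernel theorem, internal audit signed; external expert review pending)

Support file (`--supports stmt-CriticalPhenomena-4575`), QUANT lane census seat prim-quant-census-2 (gen 80); memo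
`run/shared/lean/prim/quant/prim-quant-census-2-g80/TRIPLE-G80.md` §3.  Theorems only, standard axioms, no sorries, no definitions.  The list-binder
forms of `sdec_gluedThree_trueFloor` (`…QuantGluedTripleTrueFloor`), as `…QuantDepthOneTripleForests` did for the `q²·y` version:

* **`sdec_gluedThree_le_trueFloor`** — `SDEC x (3(r+k)) (t ∗ t ∗ t)` for every `0 < x ≤ q·g` (`sdec_mono`).
* **`sdec_flaw_three_glued`** — for a sibling record `s` with `s.ρ = blobLaw [(k,g),(r,1)]`, `s.M = r+k`, `0 < s.q < 1`, `0 < g < 1` and every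
  `0 < x ≤ s.q·g`: `SDEC x (ftop [s,s,s]) (flaw [s,s,s])`.
* **`sdec_flaw_gluedTripleCore`** — the same core extended by blob-hull-reducible siblings `Lr` and tame siblings `Lt` (`sdec_append_reducible`,
  `sdec_append_tame`): `SDEC x (ftop (Lt ++ (Lr ++ [s,s,s]))) (flaw …)` — the node `SiblingStep` OUTRIGHT on these lists.

HONEST STATUS.  Families, not the node; `SiblingStep`, `FarTreeRow` OPEN; RATE class (log\*) / honest sentence of `run/shared/lean/prim/quant/README.md`
unchanged.  [this work].  Nothing here is cited as a published result.  The gluing rows served [cite: KozmaNitzan2024, Conjecture 3 (p. 15)]; product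
measure [cite: Grimmett1999, §1.3 p. 10].
-/

noncomputable section

open scoped BigOperators

namespace Summit.CriticalPhenomena.PercolationContinuityZ3.Theorems
namespace Quant
namespace LawDec

open Finset

/-- **the identical glued triple at every floor `0 < x ≤ q·g`.** [this work] -/
theorem sdec_gluedThree_le_trueFloor (r k : ℕ) {q g x : ℝ} (hq0 : 0 < q) (hq1 : q < 1) (hg0 : 0 < g) (hg1 : g < 1) (hx0 : 0 < x)
    (hx : x ≤ q * g) :
    SDEC x ((r + k) + (r + k) + (r + k))
      (lconv ((r + k) + (r + k)) (r + k)
        (lconv (r + k) (r + k) (gate (blobLaw [(k, g), (r, 1)]) q) (gate (blobLaw [(k, g), (r, 1)]) q))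
        (gate (blobLaw [(k, g), (r, 1)]) q)) := by
  have _ := hx0
  exact sdec_mono (sdec_gluedThree_trueFloor r k hq0 hq1 hg0 hg1) hx (by nlinarith)

/-- **THREE COPIES OF A GLUED SIBLING RECORD ON THE BINDER, TRUE FLOOR**: `s.ρ = blobLaw [(k,g),(r,1)]`, `s.M = r + k`, `0 < s.q < 1`, `0 < g < 1`,
`0 < x ≤ s.q·g` ⟹ `SDEC x (ftop [s,s,s]) (flaw [s,s,s])`. [this work] -/
theorem sdec_flaw_three_glued {x : ℝ} (hx0 : 0 < x) (s : Sib) (r k : ℕ) {g : ℝ} (hρ : s.ρ = blobLaw [(k, g), (r, 1)]) (hM : s.M = r + k)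
    (hq0 : 0 < s.q) (hq1 : s.q < 1) (hg0 : 0 < g) (hg1 : g < 1) (hx : x ≤ s.q * g) :
    SDEC x (ftop [s, s, s]) (flaw [s, s, s]) := by
  obtain ⟨_, aM, _, _⟩ := glued_blob_laws r k hg0.le hg1.le
  have ρM : ∀ h, s.M < h → s.ρ h = 0 := fun h hh => by rw [hρ]; exact aM h (by rw [← hM]; exact hh)
  obtain ⟨eF, eT⟩ := flaw_three_eq s s s ρM
  rw [eF, eT, hρ, hM]
  exact sdec_gluedThree_le_trueFloor r k hq0 hq1 hg0 hg1 hx0 hx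

/-- **… + REDUCIBLE + TAME SIBLINGS** (`L = Lt ++ (Lr ++ [s,s,s])`): the sibling step holds outright on every list whose hard core is three copies of
one glued sibling, at every floor `x ≤ s.q·g` that the other siblings afford. [this work] -/
theorem sdec_flaw_gluedTripleCore {x : ℝ} (hx0 : 0 < x) (s : Sib) (r k : ℕ) {g : ℝ} (hρ : s.ρ = blobLaw [(k, g), (r, 1)]) (hM : s.M = r + k)
    (hq0 : 0 < s.q) (hq1 : s.q < 1) (hg0 : 0 < g) (hg1 : g < 1) (hx : x ≤ s.q * g)
    (Lr : List Sib) (hLr : ∀ s ∈ Lr, s.LawOK) (hxLr : ∀ s ∈ Lr, x * (s.M : ℝ) ≤ s.q * s.mean)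
    (hred : ∀ s ∈ Lr, ∃ m : ℝ, InBlobHull x m s.M (gate s.ρ s.q))
    (Lt : List Sib) (hLt : ∀ s ∈ Lt, s.LawOK) (hxLt : ∀ s ∈ Lt, x * (s.M : ℝ) ≤ s.q * s.mean)
    (htame : ∀ s ∈ Lt, ∀ h : ℕ, 1 ≤ h → s.ρ h ≠ 0 → s.q * s.mean ≤ 2 * h ∨ x * ((s.M : ℝ) - h) ≤ s.q * s.mean - h) :
    SDEC x (ftop (Lt ++ (Lr ++ [s, s, s]))) (flaw (Lt ++ (Lr ++ [s, s, s]))) := by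
  have hS := sdec_flaw_three_glued hx0 s r k hρ hM hq0 hq1 hg0 hg1 hx
  have hx1 : x < 1 := by nlinarith
  -- `s.ρ` lies in the blob hull at floor `g` with mean `r + kg`
  have hl : ∀ p ∈ [((k : ℕ), g), (r, (1 : ℝ))], g ≤ p.2 ∧ p.2 ≤ 1 := by
    intro p hp
    simp only [List.mem_cons, List.mem_nil_iff, or_false] at hp
    rcases hp with rfl | rfl
    · exact ⟨le_rfl, hg1.le⟩
    · exact ⟨hg1.le, le_rfl⟩
  have hρh : InBlobHull g ((r : ℝ) + k * g) s.M s.ρ := by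
    have h := inBlobHull_blobLaw g [((k : ℕ), g), (r, (1 : ℝ))] hl (M := r + k) (by rw [blobTop_glued])
    have em : blobMean [((k : ℕ), g), (r, (1 : ℝ))] = (r : ℝ) + k * g := by simp [blobMean]
    rw [em, ← hM, ← hρ] at h
    exact h
  have hta : g * (s.M : ℝ) ≤ (r : ℝ) + k * g := by
    rw [hM]; push_cast; nlinarith [(Nat.cast_nonneg r : (0 : ℝ) ≤ r)]
  have f := lawOK_aff_of_subBlobHull hx0 s hg0 hq0 hq1 hρh hta hx
  have hLh : ∀ t ∈ [s, s, s], t.LawOK := by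
    intro t ht; simp only [List.mem_cons, List.mem_nil_iff, or_false, or_self] at ht
    subst ht; exact f.1
  have hxLh : ∀ t ∈ [s, s, s], x * (t.M : ℝ) ≤ t.q * t.mean := by
    intro t ht; simp only [List.mem_cons, List.mem_nil_iff, or_false, or_self] at ht
    subst ht; exact f.2
  have hR := sdec_append_reducible hx0 hx1 [s, s, s] hLh hxLh hS Lr hLr hxLr hred
  have hall : ∀ t ∈ Lr ++ [s, s, s], t.LawOK := by
    intro t ht
    rcases List.mem_append.1 ht with h | h
    exacts [hLr t h, hLh t h]
  have hxall : ∀ t ∈ Lr ++ [s, s, s], x * (t.M : ℝ) ≤ t.q * t.mean := by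
    intro t ht
    rcases List.mem_append.1 ht with h | h
    exacts [hxLr t h, hxLh t h]
  exact sdec_append_tame hx0 hx1 (Lr ++ [s, s, s]) hall hxall hR Lt hLt hxLt htame

end LawDec
end Quant
end Summit.CriticalPhenomena.PercolationContinuityZ3.Theorems
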